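import Literature.Geometry.Symplectic.AlmostComplexTopChernNumberFour
import Literature.Geometry.Symplectic.HirzebruchSignatureAlmostComplexFourReduction
import Literature.Geometry.Symplectic.EulerCharacteristicAddSignatureOfSymplecticFourProofs
import Literature.Geometry.Symplectic.FirstChernClassModTwoEqWuClassFour
import HarnessLib

/-!
# What `⟨c₂(TN, J), [N]⟩ = ±χ(N)` buys: Hirzebruch's `c₁² = 2χ + 3σ` up to the sign of `χ`, and
# `1 - b₁ + b⁺` even for closed symplectic `4`-manifolds of even Euler characteristic

D. McDuff, D. Salamon, *Introduction to Symplectic Topology*, 3rd ed. (2017), Rem. 4.1.10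
eq. (4.1.7) (`c₁² = 2χ + 3σ`), Ex. 4.4.3 (v) (`⟨c₂, [X]⟩ = χ`, the signature theorem
`σ = ⅓⟨c₁² - 2c₂, [X]⟩`), §13.3 p. 527 and Rem. 13.3.5 (`χ + σ ≡ 0 (mod 4)`, i.e. `1 - b₁ + b⁺`
even, for closed symplectic / almost complex `4`-manifolds).

`AlmostComplexTopChernNumberFour` proves the top Chern number theorem UP TO SIGN,
`⟨c₂(TN, J), [N]_μ⟩ = ±χ(N)` for the orientation `μ` induced by `J`
(`kroneckerPairing_chernClass_two_eq_or_eq_neg_of_isComplexOrientationOf`).  This file threads that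
through the two reductions already in the tree — (H) `hirzebruch_firstChernClass_sq_eq_almostComplex_four`
⟸ signature theorem ∧ top Chern number theorem (`HirzebruchSignatureAlmostComplexFourReduction`), and
`even_one_add_bOne_add_bPlus_of_symplectic_four` ⟸ (H) ∧ (V) (`…SymplecticFourProofs`) — and records
exactly what the missing sign costs:

* `cupPairing_firstChernClass_eq_or_of_signatureTheorem` — **granted the signature theorem in
  dimension four (`hsig`: `⟨p₁, [N]_μ⟩ = 3σ(μ)`), `⟨c₁², [N]_μ⟩ = 2χ + 3σ` OR `= -2χ + 3σ`** for the
  orientation induced by `J`; hence (`cupPairing_firstChernClass_modEq_of_signatureTheorem_of_even`)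
  **`⟨c₁², [N]_μ⟩ ≡ 2χ + 3σ (mod 8)` whenever `χ(N)` is even** — no sign needed;
* `kroneckerPairing_chernClass_two_eq_relEuler_iff_nonneg` — per manifold, the top Chern number
  theorem `⟨c₂, [N]_μ⟩ = χ` is EQUIVALENT to the sign condition `0 ≤ ⟨c₂, [N]_μ⟩ · χ`;
  `hirzebruch_firstChernClass_sq_eq_almostComplex_four_of_signatureTheorem_of_sign` — (H) from `hsig`
  and that sign condition alone;
* `even_one_add_bOne_add_bPlus_of_signatureTheorem_of_wuClass_of_even` /
  `…_symplectic_of_signatureTheorem_of_wuClass_of_even` — **for closed connected almost complex, resp.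
  symplectic, `4`-manifolds with `χ(N)` even, `1 + b₁ + b⁺(μ)` is even GRANTED only `hsig` and (V)
  `firstChernClass_modTwo_eq_wuClass_almostComplex_four`** (the top Chern number theorem drops out:
  both signs agree modulo `8`);
* `even_one_add_bOne_add_bPlus_of_symplectic_four_of_signatureTheorem_of_sign_of_wuClass` — the
  named fact in general from `hsig`, the sign condition and (V).

Everything is proved; no named facts (the hypotheses `hsig`, `hsgn`, `hV` are binders of theorems).

## References

* [McDuffSalamon2017] D. McDuff, D. Salamon, Introduction to Symplectic Topology, 3rd ed., OUP 2017,
  Rem. 4.1.10 eq. (4.1.7), Ex. 4.4.3 (v), §13.3 p. 527, Rem. 13.3.5.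
* [Hirzebruch1966] F. Hirzebruch, Topological Methods in Algebraic Geometry, 3rd ed. 1966,
  Thm. 4.5.1, Thm. 4.10.1, Thm. 8.2.2.
* [MilnorStasheff1974] J. Milnor, J. Stasheff, Characteristic Classes, PUP 1974, Cor. 11.12.
-/

noncomputable section

open scoped Manifold ContDiff Topology
open Literature.AlgebraicTopology.SingularHomology Literature.AlgebraicTopology.CharacteristicClasses
open Literature.Geometry.Kaehler

namespace Literature.Geometry.Symplectic

/-! ### Hirzebruch's formula up to the sign of `χ`, from the signature theorem -/

section Hirzebruch

/-- **`⟨c₁², [N]_μ⟩ = 2χ + 3σ(μ)` or `= -2χ + 3σ(μ)`, granted the signature theorem in dimension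
four** (`hsig`: `⟨p₁, [N]_μ⟩ = 3σ(μ)`, Hirzebruch Thm. 8.2.2): `3σ = ⟨c₁² - 2c₂, [N]⟩`
(`three_mul_signature_eq_of_signatureTheorem`, `p₁ = c₁² - 2c₂`) and `⟨c₂, [N]_μ⟩ = ±χ`
(`kroneckerPairing_chernClass_two_eq_or_eq_neg_of_isComplexOrientationOf`).
[cite: McDuffSalamon2017, Rem. 4.1.10 eq. (4.1.7) and Ex. 4.4.3 (v)] [cite: Hirzebruch1966, Thm. 4.5.1, Thm. 4.10.1, Thm. 8.2.2] -/
theorem cupPairing_firstChernClass_eq_or_of_signatureTheorem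
    (hsig : ∀ (N : Type) [TopologicalSpace N] [T2Space N] [SecondCountableTopology N]
      [CompactSpace N] [ConnectedSpace N] [ChartedSpace (EuclideanSpace ℝ (Fin 4)) N]
      [IsManifold (𝓡 4) ∞ N] (μ : HomologicalOrientation ℤ N 4),
      kroneckerPairing ℤ ℤ N 4 (degCast ℤ (by norm_num : 4 * 1 = 4) (tangentPontryaginClass (𝓡 4) N 1))
        μ.fundamentalClass = 3 * μ.signature)
    (N : Type) [TopologicalSpace N] [T2Space N] [SecondCountableTopology N]
    [CompactSpace N] [ConnectedSpace N] [ChartedSpace (EuclideanSpace ℝ (Fin 4)) N]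
    [IsManifold (𝓡 4) ∞ N] (J : AlmostComplexStructure (𝓡 4) ∞ N) (μ : HomologicalOrientation ℤ N 4)
    (hμ : μ.IsComplexOrientationOf J) :
    cupPairing μ two_add_two_eq_four J.firstChernClass J.firstChernClass =
        2 * relEuler ℤ ℤ N ∅ + 3 * μ.signature ∨
      cupPairing μ two_add_two_eq_four J.firstChernClass J.firstChernClass =
        -(2 * relEuler ℤ ℤ N ∅) + 3 * μ.signature := by
  have h3 := three_mul_signature_eq_of_signatureTheorem hsig N J μ
  rcases kroneckerPairing_chernClass_two_eq_or_eq_neg_of_isComplexOrientationOf J μ hμ with h | h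
  · left
    rw [h] at h3
    linarith
  · right
    rw [h] at h3
    linarith

/-- **`⟨c₁², [N]_μ⟩ ≡ 2χ + 3σ(μ) (mod 8)` when `χ(N)` is even, granted the signature theorem** — the
two possible values `±2χ + 3σ` differ by `4χ ≡ 0 (mod 8)`. [cite: McDuffSalamon2017, Rem. 4.1.10 eq. (4.1.7) and §13.3 p. 527] -/
theorem cupPairing_firstChernClass_modEq_of_signatureTheorem_of_even
    (hsig : ∀ (N : Type) [TopologicalSpace N] [T2Space N] [SecondCountableTopology N]
      [CompactSpace N] [ConnectedSpace N] [ChartedSpace (EuclideanSpace ℝ (Fin 4)) N]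
      [IsManifold (𝓡 4) ∞ N] (μ : HomologicalOrientation ℤ N 4),
      kroneckerPairing ℤ ℤ N 4 (degCast ℤ (by norm_num : 4 * 1 = 4) (tangentPontryaginClass (𝓡 4) N 1))
        μ.fundamentalClass = 3 * μ.signature)
    (N : Type) [TopologicalSpace N] [T2Space N] [SecondCountableTopology N]
    [CompactSpace N] [ConnectedSpace N] [ChartedSpace (EuclideanSpace ℝ (Fin 4)) N]
    [IsManifold (𝓡 4) ∞ N] (J : AlmostComplexStructure (𝓡 4) ∞ N) (μ : HomologicalOrientation ℤ N 4)
    (hμ : μ.IsComplexOrientationOf J) (hχ : Even (relEuler ℤ ℤ N ∅)) :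
    cupPairing μ two_add_two_eq_four J.firstChernClass J.firstChernClass ≡
      2 * relEuler ℤ ℤ N ∅ + 3 * μ.signature [ZMOD 8] := by
  rcases cupPairing_firstChernClass_eq_or_of_signatureTheorem hsig N J μ hμ with h | h
  · rw [h]
  · rw [h]
    obtain ⟨k, hk⟩ := hχ
    exact Int.modEq_iff_dvd.2 ⟨k, by rw [hk]; ring⟩

/-- **Per manifold, the top Chern number theorem is equivalent to a sign condition**: since
`⟨c₂, [N]_μ⟩ = ±χ(N)` for the orientation induced by `J`, `⟨c₂, [N]_μ⟩ = χ(N)` iff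
`0 ≤ ⟨c₂, [N]_μ⟩ · χ(N)`. [cite: McDuffSalamon2017, Ex. 4.4.3 (v)] [cite: MilnorStasheff1974, Cor. 11.12] -/
theorem kroneckerPairing_chernClass_two_eq_relEuler_iff_nonneg
    {N : Type} [TopologicalSpace N] [T2Space N] [CompactSpace N] [ConnectedSpace N]
    [ChartedSpace (EuclideanSpace ℝ (Fin 4)) N] [IsManifold (𝓡 4) ∞ N]
    (J : AlmostComplexStructure (𝓡 4) ∞ N) (μ : HomologicalOrientation ℤ N 4) (hμ : μ.IsComplexOrientationOf J) :
    kroneckerPairing ℤ ℤ N 4 (degCast ℤ (by norm_num : 2 * 2 = 4) (J.chernClass 2)) μ.fundamentalClass =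
        relEuler ℤ ℤ N ∅ ↔
      0 ≤ kroneckerPairing ℤ ℤ N 4 (degCast ℤ (by norm_num : 2 * 2 = 4) (J.chernClass 2)) μ.fundamentalClass *
        relEuler ℤ ℤ N ∅ := by
  refine ⟨fun h ↦ by rw [h]; exact mul_self_nonneg _, fun hs ↦ ?_⟩
  rcases kroneckerPairing_chernClass_two_eq_or_eq_neg_of_isComplexOrientationOf J μ hμ with h | h
  · exact h
  · rw [h] at hs ⊢
    have h0 : relEuler ℤ ℤ N ∅ * relEuler ℤ ℤ N ∅ = 0 :=
      le_antisymm (by nlinarith [hs]) (mul_self_nonneg _)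
    rw [mul_self_eq_zero.1 h0, neg_zero]

/-- **Hirzebruch's `c₁² = 2χ + 3σ` (the named fact
`hirzebruch_firstChernClass_sq_eq_almostComplex_four`) from the signature theorem in dimension four
and the SIGN of the top Chern number only** (`hsgn`: `0 ≤ ⟨c₂(TN, J), [N]_μ⟩ · χ(N)` for the
orientation induced by `J`) — the hypothesis `hc₂` of
`hirzebruch_firstChernClass_sq_eq_almostComplex_four_of_signatureTheorem_of_topChernNumber` is
supplied by `kroneckerPairing_chernClass_two_eq_relEuler_iff_nonneg`.
[cite: McDuffSalamon2017, Rem. 4.1.10 eq. (4.1.7) and Ex. 4.4.3 (v)] [cite: Hirzebruch1966, Thm. 4.10.1 and Thm. 8.2.2] -/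
theorem hirzebruch_firstChernClass_sq_eq_almostComplex_four_of_signatureTheorem_of_sign
    (hsig : ∀ (N : Type) [TopologicalSpace N] [T2Space N] [SecondCountableTopology N]
      [CompactSpace N] [ConnectedSpace N] [ChartedSpace (EuclideanSpace ℝ (Fin 4)) N]
      [IsManifold (𝓡 4) ∞ N] (μ : HomologicalOrientation ℤ N 4),
      kroneckerPairing ℤ ℤ N 4 (degCast ℤ (by norm_num : 4 * 1 = 4) (tangentPontryaginClass (𝓡 4) N 1))
        μ.fundamentalClass = 3 * μ.signature)
    (hsgn : ∀ (N : Type) [TopologicalSpace N] [T2Space N] [SecondCountableTopology N]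
      [CompactSpace N] [ConnectedSpace N] [ChartedSpace (EuclideanSpace ℝ (Fin 4)) N]
      [IsManifold (𝓡 4) ∞ N] (J : AlmostComplexStructure (𝓡 4) ∞ N)
      (μ : HomologicalOrientation ℤ N 4), μ.IsComplexOrientationOf J →
      0 ≤ kroneckerPairing ℤ ℤ N 4 (degCast ℤ (by norm_num : 2 * 2 = 4) (J.chernClass 2)) μ.fundamentalClass *
        relEuler ℤ ℤ N ∅) :
    hirzebruch_firstChernClass_sq_eq_almostComplex_four :=
  hirzebruch_firstChernClass_sq_eq_almostComplex_four_of_signatureTheorem_of_topChernNumber hsig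
    fun N _ _ _ _ _ _ _ J μ hμ ↦
      (kroneckerPairing_chernClass_two_eq_relEuler_iff_nonneg J μ hμ).2 (hsgn N J μ hμ)

end Hirzebruch

/-! ### `1 + b₁ + b⁺` even for even `χ`, from the signature theorem and `c₁ ≡ v₂ (mod 2)` -/

section Parity

/-- **For a closed connected almost complex `4`-manifold with `χ(N)` even, `1 + b₁ + b⁺(μ)` is even
for the orientation induced by `J` — granted the signature theorem (`hsig`) and (V) `c₁(TN, J) ≡ v₂(N)
(mod 2)` only**: `⟨c₁², [N]⟩ ≡ 2χ + 3σ (mod 8)`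
(`cupPairing_firstChernClass_modEq_of_signatureTheorem_of_even`) and (V) feed the lattice/Betti
assembly `even_one_add_bOne_add_bPlus_of_sq_modEq_of_forall_even` (van der Blij).
[cite: McDuffSalamon2017, §13.3 p. 527 and Rem. 4.1.10 (pp. 161–162)] -/
theorem even_one_add_bOne_add_bPlus_of_signatureTheorem_of_wuClass_of_even
    (hsig : ∀ (N : Type) [TopologicalSpace N] [T2Space N] [SecondCountableTopology N]
      [CompactSpace N] [ConnectedSpace N] [ChartedSpace (EuclideanSpace ℝ (Fin 4)) N]
      [IsManifold (𝓡 4) ∞ N] (μ : HomologicalOrientation ℤ N 4),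
      kroneckerPairing ℤ ℤ N 4 (degCast ℤ (by norm_num : 4 * 1 = 4) (tangentPontryaginClass (𝓡 4) N 1))
        μ.fundamentalClass = 3 * μ.signature)
    (hV : firstChernClass_modTwo_eq_wuClass_almostComplex_four)
    {N : Type} [TopologicalSpace N] [T2Space N] [SecondCountableTopology N] [CompactSpace N]
    [ConnectedSpace N] [ChartedSpace (EuclideanSpace ℝ (Fin 4)) N] [IsManifold (𝓡 4) ∞ N]
    (J : AlmostComplexStructure (𝓡 4) ∞ N) (μ : HomologicalOrientation ℤ N 4)
    (hμ : μ.IsComplexOrientationOf J) (hχ : Even (relEuler ℤ ℤ N ∅)) :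
    Even (1 + Module.finrank ℤ (singularHomology ℤ ℤ N 1) +
      sigPos (intersectionForm two_add_two_eq_four μ).toQuadraticMap) :=
  even_one_add_bOne_add_bPlus_of_sq_modEq_of_forall_even μ J.firstChernClass
    (cupPairing_firstChernClass_modEq_of_signatureTheorem_of_even hsig N J μ hμ hχ)
    (forall_even_of_ringChange_eq_wuClass μ J.firstChernClass (hV N J))

/-- **For a closed connected symplectic `4`-manifold `(N, s)` with `χ(N)` even, `1 + b₁ + b⁺(μ)` is
even for the symplectic orientation — granted the signature theorem and (V) only**: the chosen
`s`-compatible `J` (`compatibleAlmostComplexStructureOf`) induces the symplectic orientation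
(`isSymplecticOrientationOf_iff_isComplexOrientationOf`), and the almost complex case applies.  The top
Chern number theorem is NOT needed for this half of `even_one_add_bOne_add_bPlus_of_symplectic_four`.
[cite: McDuffSalamon2017, §13.3 p. 527, Rem. 13.3.5, Rem. 4.1.10, Prop. 4.1.1 (i), Def. 4.1.4] -/
theorem even_one_add_bOne_add_bPlus_symplectic_of_signatureTheorem_of_wuClass_of_even
    (hsig : ∀ (N : Type) [TopologicalSpace N] [T2Space N] [SecondCountableTopology N]
      [CompactSpace N] [ConnectedSpace N] [ChartedSpace (EuclideanSpace ℝ (Fin 4)) N]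
      [IsManifold (𝓡 4) ∞ N] (μ : HomologicalOrientation ℤ N 4),
      kroneckerPairing ℤ ℤ N 4 (degCast ℤ (by norm_num : 4 * 1 = 4) (tangentPontryaginClass (𝓡 4) N 1))
        μ.fundamentalClass = 3 * μ.signature)
    (hV : firstChernClass_modTwo_eq_wuClass_almostComplex_four)
    {N : Type} [TopologicalSpace N] [T2Space N] [SecondCountableTopology N] [CompactSpace N]
    [ConnectedSpace N] [ChartedSpace (EuclideanSpace ℝ (Fin 4)) N] [IsManifold (𝓡 4) ∞ N]
    (s : MForm (𝓡 4) N ℝ 2) (hs : IsSmoothForm s) (hcl : IsClosedForm s)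
    (hnd : ∀ x (v : TangentSpace (𝓡 4) x), v ≠ 0 → ∃ w, s x ![v, w] ≠ 0)
    (μ : HomologicalOrientation ℤ N 4) (hμ : μ.IsSymplecticOrientationOf s hs hcl)
    (hχ : Even (relEuler ℤ ℤ N ∅)) :
    Even (1 + Module.finrank ℤ (singularHomology ℤ ℤ N 1) +
      sigPos (intersectionForm two_add_two_eq_four μ).toQuadraticMap) := by
  have hJ := isCompatibleWith_compatibleAlmostComplexStructureOf s hs hnd
  have hμJ : μ.IsComplexOrientationOf (compatibleAlmostComplexStructureOf s hs hnd) :=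
    (isSymplecticOrientationOf_iff_isComplexOrientationOf hJ hs hcl μ).1 hμ
  exact even_one_add_bOne_add_bPlus_of_signatureTheorem_of_wuClass_of_even hsig hV _ μ hμJ hχ

/-- **The named fact `even_one_add_bOne_add_bPlus_of_symplectic_four` from the signature theorem,
the SIGN of the top Chern number, and (V)** (`…_of_hirzebruch_of_wuClass` with (H) supplied by
`hirzebruch_firstChernClass_sq_eq_almostComplex_four_of_signatureTheorem_of_sign`).
[cite: McDuffSalamon2017, §13.3 p. 527, Rem. 13.3.5, Rem. 4.1.10 eq. (4.1.7), Ex. 4.4.3 (v)] -/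
theorem even_one_add_bOne_add_bPlus_of_symplectic_four_of_signatureTheorem_of_sign_of_wuClass
    (hsig : ∀ (N : Type) [TopologicalSpace N] [T2Space N] [SecondCountableTopology N]
      [CompactSpace N] [ConnectedSpace N] [ChartedSpace (EuclideanSpace ℝ (Fin 4)) N]
      [IsManifold (𝓡 4) ∞ N] (μ : HomologicalOrientation ℤ N 4),
      kroneckerPairing ℤ ℤ N 4 (degCast ℤ (by norm_num : 4 * 1 = 4) (tangentPontryaginClass (𝓡 4) N 1))
        μ.fundamentalClass = 3 * μ.signature)
    (hsgn : ∀ (N : Type) [TopologicalSpace N] [T2Space N] [SecondCountableTopology N]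
      [CompactSpace N] [ConnectedSpace N] [ChartedSpace (EuclideanSpace ℝ (Fin 4)) N]
      [IsManifold (𝓡 4) ∞ N] (J : AlmostComplexStructure (𝓡 4) ∞ N)
      (μ : HomologicalOrientation ℤ N 4), μ.IsComplexOrientationOf J →
      0 ≤ kroneckerPairing ℤ ℤ N 4 (degCast ℤ (by norm_num : 2 * 2 = 4) (J.chernClass 2)) μ.fundamentalClass *
        relEuler ℤ ℤ N ∅)
    (hV : firstChernClass_modTwo_eq_wuClass_almostComplex_four) :
    even_one_add_bOne_add_bPlus_of_symplectic_four :=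
  even_one_add_bOne_add_bPlus_of_symplectic_four_of_hirzebruch_of_wuClass
    (hirzebruch_firstChernClass_sq_eq_almostComplex_four_of_signatureTheorem_of_sign hsig hsgn) hV

end Parity

end Literature.Geometry.Symplectic

end
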